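import Summits.QuantumFields.BalabanUV.Beta.EriceFlowEnclosureB12AsPrintedPointwiseFadingOrderInterval

/-!
# Beta / EriceFlowEnclosureB12AsPrintedPointwiseFadingOrderContinuous — WHAT (0.31) FORCES POINTWISE, part 7c: «g₀ = g₀(ε, ·)» IS AN INCREASING HOMEOMORPHISM BETWEEN
# INTERVALS, SIGN-FREE.  Part 7b (`…PointwiseFadingOrderInterval`) made the admissible bare couplings A = {g₀ : the run (K, m, g₀) stays in ]0, γ]} an INTERVAL on which the renormalized
# coupling g_K is STRICTLY INCREASING (node U2's coupling-chart moduli `HistLipschitz Λ γ S.β`, `FadingMemory C θ Λ`, 0 ≤ θ < 1, 4Cγ³ ≤ (1−θ)², the printed `Definitions`, (U) with b′γ² < 1).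
# Here the CONTINUITY letter (C) `FlowStep.BetaContH γ S.β` (p. 263–264, said of the last variable; history-wide it is a HYPOTHESIS SHAPE) is added: along A every coupling g_j is a continuous
# function of the bare coupling ((0.20) solved forward: g_{j+1} = (1∕g_j² − β_{j+1}(g₀, …, g_j))^{−1∕2}, a composition of continuous maps — **`cpl_continuousOn`**, NO moduli needed), so the
# endpoint map is continuous on A (**`endpoint_continuousOn`**), its image is again an INTERVAL (**`endpoint_image_ordConnected`**, intermediate values), and with part 7b's strict monotonicity
# it is an ORDER-ISOMORPHISM, hence a HOMEOMORPHISM, of A onto its image (**`endpoint_homeomorph`**): on every lattice the inverse «g ↦ g₀(ε, g)» is a continuous strictly increasing function on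
# an interval of renormalized couplings — which by Theorem 2 AS TYPED contains ]0, g₁] (END **`theorem2_bareCoupling_homeomorph_signFree`**).  Sign-free, AF-free, no uniform reading; prover 1's
# #62g `theorem2_bareCoupling_lipschitz` keeps the K-UNIFORM Lipschitz modulus as the genuine AF content
# (β-flow team, prover 2 = lower ∕ positivity side, unit `b2b-balaban-beta-bflow-p2`, gen 44; ROW AP-I × node U2's letters; companion of parts 7 ∕ 7b)

HONEST FRAMING (page 1 of everything the β sub-cell writes): discharging `BetaPertH` makes Bałaban's UV stability UNCONDITIONAL — a
real constructive-QFT result; it is NOT the continuum limit and NOT the Clay problem.  HONEST DEPENDENCY (cell reorg 2026-08-19,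
verbatim): «continuum YM on T⁴ ⇐ BetaPertH ∧ nine spine estimates (0/9 proved); BetaPertH ⇐ (D1) ∧ (D4) ∧ CAP+tail; G-an2-4 gates
asym, D1 and NE2/3/4.»  THIS MODULE DISCHARGES NOTHING: bookkeeping from the NAMED FIELDS of the statement-exact typing `B12BetaAsPrinted` of [I] = T. Bałaban, Commun. Math.
Phys. **109** (1987) [Balaban1987RG1] (`Definitions` d018∕d020; `Theorem2Statement` — STATED WITHOUT PROOF, p. 259 — a HYPOTHESIS of the END), the letters (U) (p. 264 «uniformly
bounded») and (C) (pp. 263–264, `FlowStep.BetaContH`), and node U2's HYPOTHESIS SHAPES `HistLipschitz` ∕ `FadingMemory` (NOT printed; GAPS G-t4-U2-2), plus Mathlib's order topology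
(`StrictMonoOn.orderIso`, `OrderIso.toHomeomorph`, `isPreconnected_iff_ordConnected`).  Nothing of Bałaban's (1.22) is asserted.

WHAT THIS FILE PROVES (0 sorry, 0 def): **`cpl_continuousOn`** (every g_j, j ≤ K, is continuous in g₀ on A — `Definitions` + (U) + (C) only), `endpoint_continuousOn`,
**`endpoint_image_ordConnected`**, **`endpoint_homeomorph`** (A ≃ₜ its image, realised by the endpoint map, order-preserving), END **`theorem2_bareCoupling_homeomorph_signFree`**.
NOT CLAIMED: any modulus, sign or bound for Bałaban's β; which reading print intends; Theorem 2; `BetaPertH`; continuum; Clay.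
-/

namespace Summit.QuantumFields.BalabanUV.Beta.EriceFlowEnclosureB12AsPrintedPointwiseFadingOrderContinuous

open Literature.MathematicalPhysics.QuantumFieldTheory.Balaban1983to89
open Literature.MathematicalPhysics.QuantumFieldTheory.Balaban1983to89.B12BetaAsPrinted
open Literature.MathematicalPhysics.QuantumFieldTheory.Balaban1983to89.FlowStep (HBeta prefixOf Box mem_box box_mono RGEqH BetaUpperH BetaContH)
open Literature.MathematicalPhysics.QuantumFieldTheory.Balaban1983to89.T4CouplingMatching (HistLipschitz FadingMemory)
open Summit.QuantumFields.BalabanUV.Beta.EriceFlowEnclosureB12AsPrintedTunedUpper (hrg_of_betaUpperH prefixOf_mem_box_of_inInterval)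
open Summit.QuantumFields.BalabanUV.Beta.EriceFlowEnclosureB12AsPrintedPointwiseFadingOrder (theorem2_existsUnique_of_fadingMemory_signFree)
open Summit.QuantumFields.BalabanUV.Beta.EriceFlowEnclosureB12AsPrintedPointwiseFadingOrderInterval (admissible_ordConnected endpoint_strictMonoOn)

noncomputable section

variable {S : Setting}

/-- **EVERY COUPLING IS CONTINUOUS IN THE BARE COUPLING ALONG THE ADMISSIBLE SET.**  For a setting with the printed `Definitions`, the upper letter (U) `β_{k+1} ≤ b′` on ]0, γ]^{k+1}
with b′γ² < 1 (so (0.20) holds along in-]0, γ]-interval runs, `hrg_of_betaUpperH`) and the continuity letter (C) `BetaContH γ S.β`: for every j ≤ K the map g₀ ↦ g_j of the run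
(K, m, g₀) is continuous on A := {g₀ : the run stays in ]0, γ]} — by induction through (0.20) solved forward, g_{j+1} = (1∕g_j² − β_{j+1}(g₀, …, g_j))^{−1∕2}.  No moduli, no sign.
[cite: Balaban1987RG1, (0.18)–(0.20) pp.255–256 and pp.263–264 (continuity of β)] -/
theorem cpl_continuousOn (hD : Definitions S) {γ b' : ℝ} (hγ : 0 < γ) (hup : BetaUpperH b' γ S.β) (hbγ : b' * γ ^ 2 < 1)
    (hcont : BetaContH γ S.β) (K m : ℕ) :
    ∀ j, j ≤ K → ContinuousOn (fun y : ℝ => S.cpl ⟨K, m, y⟩ j) {y : ℝ | Step.InInterval γ K (S.cpl ⟨K, m, y⟩)} := by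
  set A : Set ℝ := {y : ℝ | Step.InInterval γ K (S.cpl ⟨K, m, y⟩)} with hA
  have hrg : ∀ y ∈ A, RGEqH K S.β (S.cpl ⟨K, m, y⟩) := fun y hy => hrg_of_betaUpperH hD hγ hup hbγ ⟨K, m, y⟩ hy
  suffices H : ∀ j, j ≤ K → ∀ i, i ≤ j → ContinuousOn (fun y : ℝ => S.cpl ⟨K, m, y⟩ i) A from fun j hj => H j hj j le_rfl
  intro j
  induction j with
  | zero =>
    intro _ i hi
    obtain rfl := Nat.le_zero.mp hi
    exact continuousOn_id.congr fun y _ => hD.d018 ⟨K, m, y⟩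
  | succ j ih =>
    intro hj1 i hi
    rcases lt_or_eq_of_le hi with hlt | rfl
    · exact ih (Nat.le_of_succ_le hj1) i (Nat.lt_succ_iff.mp hlt)
    · have hjK : j < K := Nat.lt_of_succ_le hj1
      have ih' := ih hjK.le
      -- the forward formula on A
      have hG : ContinuousOn (fun y : ℝ => 1 / (S.cpl ⟨K, m, y⟩ j) ^ 2 - S.β j (prefixOf (S.cpl ⟨K, m, y⟩) j)) A := by
        refine ContinuousOn.sub ?_ ?_
        · exact continuousOn_const.div ((ih' j le_rfl).pow 2) fun y hy => pow_ne_zero 2 (hy j hjK.le).1.ne'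
        · have hpre : ContinuousOn (fun y : ℝ => prefixOf (S.cpl ⟨K, m, y⟩) j) A :=
            continuousOn_pi.mpr fun i => by
              simpa only [FlowStep.prefixOf_apply] using ih' i (Nat.lt_succ_iff.mp i.isLt)
          exact (hcont j).comp hpre fun y hy => prefixOf_mem_box_of_inInterval hy hjK.le
      have hGpos : ∀ y ∈ A, 0 < 1 / (S.cpl ⟨K, m, y⟩ j) ^ 2 - S.β j (prefixOf (S.cpl ⟨K, m, y⟩) j) := by
        intro y hy
        have e := hrg y hy j hjK
        have hpos := (hy (j + 1) hj1).1
        have : 0 < 1 / (S.cpl ⟨K, m, y⟩ (j + 1)) ^ 2 := by positivity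
        linarith
      have hF : ContinuousOn (fun y : ℝ => 1 / Real.sqrt (1 / (S.cpl ⟨K, m, y⟩ j) ^ 2 - S.β j (prefixOf (S.cpl ⟨K, m, y⟩) j))) A :=
        continuousOn_const.div (Real.continuous_sqrt.comp_continuousOn hG) fun y hy => (Real.sqrt_pos.mpr (hGpos y hy)).ne'
      refine hF.congr fun y hy => ?_
      -- g_{j+1} = (1/g_j² − β)^{-1/2} along A
      have e := hrg y hy j hjK
      have hpos := (hy (j + 1) hj1).1
      have hval : 1 / (S.cpl ⟨K, m, y⟩ j) ^ 2 - S.β j (prefixOf (S.cpl ⟨K, m, y⟩) j) = (1 / S.cpl ⟨K, m, y⟩ (j + 1)) ^ 2 := by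
        rw [one_div_pow]; linarith
      show S.cpl ⟨K, m, y⟩ (j + 1) = 1 / Real.sqrt (1 / (S.cpl ⟨K, m, y⟩ j) ^ 2 - S.β j (prefixOf (S.cpl ⟨K, m, y⟩) j))
      rw [hval, Real.sqrt_sq (by positivity), one_div_one_div]

/-- In particular the endpoint map g₀ ↦ g_K is continuous on the admissible set. [cite: Balaban1987RG1, (0.18)–(0.20) pp.255–256 and pp.263–264] -/
theorem endpoint_continuousOn (hD : Definitions S) {γ b' : ℝ} (hγ : 0 < γ) (hup : BetaUpperH b' γ S.β) (hbγ : b' * γ ^ 2 < 1)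
    (hcont : BetaContH γ S.β) (K m : ℕ) :
    ContinuousOn (fun y : ℝ => S.cpl ⟨K, m, y⟩ K) {y : ℝ | Step.InInterval γ K (S.cpl ⟨K, m, y⟩)} :=
  cpl_continuousOn hD hγ hup hbγ hcont K m K le_rfl

/-- **THE ATTAINABLE RENORMALIZED COUPLINGS FORM AN INTERVAL.**  With part 7b's letters (`Definitions`, (U) with b′γ² < 1, node U2's moduli with 4Cγ³ ≤ (1−θ)²) plus (C): the image of the
admissible interval under the continuous endpoint map is ORDER-CONNECTED (intermediate value theorem: a continuous image of an interval is an interval).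
[cite: Balaban1987RG1, Thm 2 p.259 («g₀ = g₀(ε, g)») with (0.18)–(0.20) pp.255–256] -/
theorem endpoint_image_ordConnected (hD : Definitions S) {γ b' θ C : ℝ} {Λ : ℕ → ℕ → ℝ}
    (hθ0 : 0 ≤ θ) (hθ1 : θ < 1) (hC : 0 ≤ C) (hγ : 0 < γ) (hup : BetaUpperH b' γ S.β) (hbγ : b' * γ ^ 2 < 1) (hcont : BetaContH γ S.β)
    (hL : HistLipschitz Λ γ S.β) (hΛ : FadingMemory C θ Λ) (hsmall : 4 * C * γ ^ 3 ≤ (1 - θ) ^ 2) (K m : ℕ) :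
    Set.OrdConnected ((fun y : ℝ => S.cpl ⟨K, m, y⟩ K) '' {y : ℝ | Step.InInterval γ K (S.cpl ⟨K, m, y⟩)}) :=
  isPreconnected_iff_ordConnected.mp
    (((admissible_ordConnected hD hθ0 hθ1 hC hγ hup hbγ hL hΛ hsmall K m).isPreconnected).image _
      (endpoint_continuousOn hD hγ hup hbγ hcont K m))

/-- **THE ENDPOINT MAP IS AN INCREASING HOMEOMORPHISM OF THE ADMISSIBLE INTERVAL ONTO ITS IMAGE.**  Same letters: there is a homeomorphism e between A = {g₀ : run in ]0, γ]} and its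
image under g₀ ↦ g_K which IS that map (e g₀ = g_K) and preserves the order both ways — so on every lattice the inverse «g ↦ g₀(ε, g)» is a continuous, strictly increasing function on
an interval.  (Part 7b's strict monotonicity ⟹ `StrictMonoOn.orderIso`; on order-connected subsets of ℝ the order topology is the subspace topology, so the order isomorphism is a
homeomorphism.) [cite: Balaban1987RG1, Thm 2 p.259 («g₀ = g₀(ε, g)») with (0.18)–(0.20) pp.255–256, pp.263–264 and p.298] -/
theorem endpoint_homeomorph (hD : Definitions S) {γ b' θ C : ℝ} {Λ : ℕ → ℕ → ℝ}
    (hθ0 : 0 ≤ θ) (hθ1 : θ < 1) (hC : 0 ≤ C) (hγ : 0 < γ) (hup : BetaUpperH b' γ S.β) (hbγ : b' * γ ^ 2 < 1) (hcont : BetaContH γ S.β)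
    (hL : HistLipschitz Λ γ S.β) (hΛ : FadingMemory C θ Λ) (hsmall : 4 * C * γ ^ 3 ≤ (1 - θ) ^ 2) (K m : ℕ) :
    ∃ e : {y : ℝ | Step.InInterval γ K (S.cpl ⟨K, m, y⟩)} ≃ₜ
        ((fun y : ℝ => S.cpl ⟨K, m, y⟩ K) '' {y : ℝ | Step.InInterval γ K (S.cpl ⟨K, m, y⟩)}),
      (∀ y, (e y : ℝ) = S.cpl ⟨K, m, (y : ℝ)⟩ K) ∧ ∀ y y', y ≤ y' ↔ e y ≤ e y' := by
  haveI hA : Set.OrdConnected {y : ℝ | Step.InInterval γ K (S.cpl ⟨K, m, y⟩)} :=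
    admissible_ordConnected hD hθ0 hθ1 hC hγ hup hbγ hL hΛ hsmall K m
  haveI hB : Set.OrdConnected ((fun y : ℝ => S.cpl ⟨K, m, y⟩ K) '' {y : ℝ | Step.InInterval γ K (S.cpl ⟨K, m, y⟩)}) :=
    endpoint_image_ordConnected hD hθ0 hθ1 hC hγ hup hbγ hcont hL hΛ hsmall K m
  have hmono := endpoint_strictMonoOn hD hθ0 hθ1 hC hγ hup hbγ hL hΛ hsmall K m
  let eo := hmono.orderIso (fun y : ℝ => S.cpl ⟨K, m, y⟩ K) {y : ℝ | Step.InInterval γ K (S.cpl ⟨K, m, y⟩)}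
  refine ⟨eo.toHomeomorph, fun y => rfl, fun y y' => ?_⟩
  show y ≤ y' ↔ eo y ≤ eo y'
  exact eo.le_iff_le.symm

/-- **END — ON EVERY LATTICE «g₀ = g₀(ε, ·)» IS A CONTINUOUS STRICTLY INCREASING FUNCTION ON AN INTERVAL CONTAINING ]0, g₁], SIGN-FREE.**  `Theorem2Statement S hL` AS TYPED (a HYPOTHESIS),
the printed `Definitions`, the letters (U) `β_{k+1} ≤ b′` on ]0, γ_u]^{k+1} and (C) `BetaContH γ_u S.β`, node U2's moduli `HistLipschitz Λ γ_u S.β` with `FadingMemory C θ Λ` (0 ≤ θ < 1), one box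
size γ₁ ≤ γ_u with b′γ₁² < 1, 4Cγ₁³ ≤ (1−θ)² ⟹ for every m there is γ₂ > 0 such that for every γ ≤ γ₂ there is g₁ > 0 such that on EVERY lattice K: every g ∈ ]0, g₁] is the
renormalized coupling of exactly one admissible bare coupling, AND the endpoint map is an order-preserving homeomorphism of the admissible interval onto an interval of renormalized couplings
(which therefore contains ]0, g₁]).  No AF letter, no sign, no uniform reading of (0.31). [cite: Balaban1987RG1, Thm 2 (0.31) p.259 with (0.20) p.256, pp.263–264 and p.298] -/
theorem theorem2_bareCoupling_homeomorph_signFree {hL : Odd S.L ∧ 1 < S.L} (h : Theorem2Statement S hL) (hD : Definitions S)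
    {γu γ₁ b' θ C : ℝ} {Λ : ℕ → ℕ → ℝ} (hup : BetaUpperH b' γu S.β) (hcont : BetaContH γu S.β)
    (hL' : HistLipschitz Λ γu S.β) (hΛ : FadingMemory C θ Λ) (hθ0 : 0 ≤ θ) (hθ1 : θ < 1) (hC : 0 ≤ C)
    (hγ₁ : 0 < γ₁) (hγ₁u : γ₁ ≤ γu) (hbu : b' * γ₁ ^ 2 < 1) (hsmall : 4 * C * γ₁ ^ 3 ≤ (1 - θ) ^ 2) (m : ℕ) :
    ∃ γ₂ : ℝ, 0 < γ₂ ∧ ∀ γ : ℝ, 0 < γ → γ ≤ γ₂ → ∃ g₁ : ℝ, 0 < g₁ ∧ ∀ K : ℕ,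
      (∀ g : ℝ, 0 < g → g ≤ g₁ → ∃! g₀ : ℝ, Step.InInterval γ K (S.cpl ⟨K, m, g₀⟩) ∧ S.cpl ⟨K, m, g₀⟩ K = g) ∧
      ∃ e : {y : ℝ | Step.InInterval γ K (S.cpl ⟨K, m, y⟩)} ≃ₜ
          ((fun y : ℝ => S.cpl ⟨K, m, y⟩ K) '' {y : ℝ | Step.InInterval γ K (S.cpl ⟨K, m, y⟩)}),
        (∀ y, (e y : ℝ) = S.cpl ⟨K, m, (y : ℝ)⟩ K) ∧ (∀ y y', y ≤ y' ↔ e y ≤ e y') ∧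
        Set.OrdConnected ((fun y : ℝ => S.cpl ⟨K, m, y⟩ K) '' {y : ℝ | Step.InInterval γ K (S.cpl ⟨K, m, y⟩)}) := by
  obtain ⟨γ₂, hγ₂, hγ⟩ := theorem2_existsUnique_of_fadingMemory_signFree h hD hup hL' hΛ hθ0 hθ1 hC hγ₁ hγ₁u hbu hsmall m
  refine ⟨min γ₂ γ₁, lt_min hγ₂ hγ₁, fun γ hγpos hγle => ?_⟩
  have hγ₁le : γ ≤ γ₁ := hγle.trans (min_le_right _ _)
  have hγule : γ ≤ γu := hγ₁le.trans hγ₁u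
  obtain ⟨g₁, hg₁, hg⟩ := hγ γ hγpos (hγle.trans (min_le_left _ _))
  have hup' : BetaUpperH b' γ S.β := fun k v hv => hup k v (box_mono hγule k hv)
  have hcont' : BetaContH γ S.β := fun k => (hcont k).mono (box_mono hγule k)
  have hLγ : HistLipschitz Λ γ S.β := fun k p q hp hq => hL' k p q (box_mono hγule k hp) (box_mono hγule k hq)
  have hbγ : b' * γ ^ 2 < 1 := by
    rcases le_or_gt 0 b' with hb' | hb'
    · exact lt_of_le_of_lt (mul_le_mul_of_nonneg_left (pow_le_pow_left₀ hγpos.le hγ₁le 2) hb') hbu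
    · nlinarith [sq_nonneg γ]
  have hsmallγ : 4 * C * γ ^ 3 ≤ (1 - θ) ^ 2 :=
    (mul_le_mul_of_nonneg_left (pow_le_pow_left₀ hγpos.le hγ₁le 3) (by positivity)).trans hsmall
  refine ⟨g₁, hg₁, fun K => ⟨fun g hgpos hgle => hg g hgpos hgle K, ?_⟩⟩
  obtain ⟨e, he, hle⟩ := endpoint_homeomorph hD hθ0 hθ1 hC hγpos hup' hbγ hcont' hLγ hΛ hsmallγ K m
  exact ⟨e, he, hle, endpoint_image_ordConnected hD hθ0 hθ1 hC hγpos hup' hbγ hcont' hLγ hΛ hsmallγ K m⟩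

end

end Summit.QuantumFields.BalabanUV.Beta.EriceFlowEnclosureB12AsPrintedPointwiseFadingOrderContinuous
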